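import Summits.Langlands.Langlands.Theses.QuarterDeficit1951
import Summits.Langlands.Langlands.Theorems.CensusDeficit1951.Negative.CensusDeficit1951FalseOfEvenIcosahedralMaassFormAt1951
import Summits.Langlands.Langlands.Theorems.QuarterFingerprintDeficit.Negative.QuarterFingerprintDeficitFalseOfOddWindowCertificate

/-!
# `CensusDeficit1951` (stmt-Langlands-17933) — negative lemma modulo the parent crux's ODD-SECTOR WINDOW CERTIFICATE

Line `Sketch` (lead c1, negation direction) of crux stmt-Langlands-17933
`Summit.Langlands.Langlands.Theses.QuarterDeficit1951.CensusDeficit1951` (D), 2026-08-17.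

D says: every order-5 Dirichlet character `χ mod 1951` carries a transcript `c : MaassHeckeTraceCensus` with
`window ≥ 1/100`, `fpTol ≥ 1/100`, `fpPrimes ⊆ {2,3,5,7,11,13}` which IS a certified census of the weight-0 cuspidal
spectrum of `(Γ₀(1951), χ)` (`CertifiedMaassHeckeTraceCensus 1951 χ c`) and whose verdict `c.certifiesDeficit` is `true`.

The landed negative lemma `CensusDeficit1951_false_of_EvenIcosahedralMaassFormAt1951` (p158485) takes as hypothesis the
EXACT object (`λ = 1/4`, `μ_p² χ̄(p) ∈ Φ`, both constant-term clauses). Here the hypothesis is cut down to the literal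
output of the parent crux's live kit computation, `OddWindowCertificate` (def landed with p158019 for
stmt-Langlands-15897, stub P4 of its line `Sketch`; CERTIFICATE-B / Milestone C in `Cruxes/QuarterFingerprintDeficit/`):
an order-5 `χ`, an ODD bounded `C²` automorphic eigenfunction `u ≢ 0` on `(Γ₀(1951), χ)` with `|λ − 1/4| ≤ 1/100` and
Hecke boxes `‖μ_p − a_p‖ ≤ r_p`, `r_p (2‖a_p‖ + r_p) ≤ 1/100`, around centres with `a_p² χ̄(p) ∈ Φ` — NO cuspidality
clauses and NO exactness. The dropped cusp clauses come from oddness (landed `stub_oddConstantTerms`, p157357), the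
route ⟶ census dictionary is the landed `isMaassCuspFormOn_of_two_cusps`, the box-to-fingerprint algebra is the landed
`norm_sq_mul_sub_sq_mul_le`, and the census obstruction is the landed `not_censusDeficit1951_of_fingerprinted_window_form`
(decoding theorem I of the format, contrapositive).

What is PROVED here (kernel-checked, no `sorry`): `OddWindowCertificate → ¬ D`. Consequence for the ledger: the SAME
computation-class certificate that kills the parent target C1 (`QuarterFingerprintDeficit_false_of_OddWindowCertificate`)
kills this crux; no separate census job is needed for the refutation of D.
-/

-- `Summit.<Summit>.<Problem>`: for the single-conjunct summit `Langlands` the duplicate is mandated.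
set_option linter.dupNamespace false

namespace Summit.Langlands.Langlands.Theorems.CensusDeficit1951.Negative

open scoped ComplexConjugate
open Literature.NumberTheory.Automorphic
open Summit.Langlands.Langlands.Theses.QuarterDeficit1951
open Summit.Langlands.Langlands.Theorems.QuarterFingerprintDeficit (stub_oddConstantTerms)
open Summit.Langlands.Langlands.Theorems.QuarterFingerprintDeficit.Negative
  (OddWindowCertificate norm_chi_eq_one_of_mem norm_sq_mul_sub_sq_mul_le)

/-- **`CensusDeficit1951` is false modulo an odd-sector window certificate.** From `OddWindowCertificate` (an odd
bounded `C²` automorphic eigenfunction `u ≢ 0` on `(Γ₀(1951), χ)`, `χ` of order 5, `|λ − 1/4| ≤ 1/100`, with Hecke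
boxes around exactly fingerprinted centres at `p ≤ 13`) the certified-census crux fails: oddness gives the two
constant-term clauses (`stub_oddConstantTerms`), the dictionary `isMaassCuspFormOn_of_two_cusps` makes `u` an
`IsMaassCuspFormOn 1951 χ u λ`, `maassHeckeOp_prime` identifies the inlined `T_p` with `maassHeckeOp 1951 χ p`, the
boxes give `‖μ_p² χ̄(p) − a_p² χ̄(p)‖ ≤ 1/100` with `a_p² χ̄(p) ∈ Φ` (`norm_sq_mul_sub_sq_mul_le`, `‖χ̄(p)‖ = 1`), and
`not_censusDeficit1951_of_fingerprinted_window_form` (decoding theorem I, contrapositive) excludes every certified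
deficit transcript for this `χ`. -/
theorem CensusDeficit1951_false_of_OddWindowCertificate (H : OddWindowCertificate) : ¬ CensusDeficit1951 := by
  obtain ⟨χ, hχ, u, lam, hC2, hΔ, haut, hbdd, hodd, hne, hwin, hfp⟩ := H
  obtain ⟨hct₁, hct₂⟩ := stub_oddConstantTerms χ u haut hodd
  refine not_censusDeficit1951_of_fingerprinted_window_form ⟨χ, hχ, u, lam,
    isMaassCuspFormOn_of_two_cusps χ u lam hC2 hΔ haut hct₁ hct₂ hbdd, hne, hwin, fun p hp => ?_⟩
  obtain ⟨μ, a, r, hφ, hr0, hr, hT, hbox⟩ := hfp p hp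
  refine ⟨μ, a ^ 2 * conj (χ (p : ZMod 1951)), hφ, ?_, ?_⟩
  · funext z
    rw [maassHeckeOp_prime 1951 χ (prime_of_mem_fpPrimes hp) u z, Pi.smul_apply, smul_eq_mul]
    exact hT z
  · have hc : ‖conj (χ (p : ZMod 1951))‖ = 1 := by
      rw [Complex.norm_conj]; exact norm_chi_eq_one_of_mem χ hp
    exact norm_sq_mul_sub_sq_mul_le μ a _ r hc hr0 hr hbox

end Summit.Langlands.Langlands.Theorems.CensusDeficit1951.Negative
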